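import Summits.QuantumFields.YangMills.Theorems.AtomicSynthesisWeightedIteration

/-!
# Weighted atomic synthesis (for the tempered E3T stub of leaf 19868), part 2: flattening the double series;
`OneStepW ⇒ SlotSynthW`

Free-hands helper toward the registered stub E3T `stub_temperedMomentBoundA` of LINES «TemperedPeak» REV 2 /
«OctaveDoubling» REV 2.1 on the leaf `InfiniteVolumeContinuum.HypercubicOSDataFromInfiniteVolume` (stmt-QuantumFields-19868).
Twin of the landed `AtomicSynthesisSlotSynthFlatten` with the weight `(ρ/σ_i)^K` carried: the (round, atom) double series
of the weighted iteration (part 1, `OneStepW` with contraction `θ^{K+5}`) is absolutely summable WITH the weights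
(`summable_wabs_coefTW`, total `≤ C (P/(θσ₀))⁴ A₀ (ρ/(θσ₀))^K/(1−θ)`), re-indexed over `ℕ` via `Encodable`, giving
`slotSynthW_of_oneStepW : OneStepW b N K θ C R → … → ∃ C₁ ≥ 0, SlotSynthW b C₁ N K`.
Elementary; no stub/crux/rung/summit is closed by this file; the YM mass gap is NOT proved. [folklore]
-/

set_option autoImplicit false

noncomputable section

open scoped BigOperators Topology ContDiff
open MeasureTheory Filter Metric
open Summit.QuantumFields.YangMills.Cruxes.AtomicSynthesis.SingleSlotPlan (E4 Stage stage₀)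

namespace Summit.QuantumFields.YangMills.Theorems.AtomicSynthesisWeighted

section Flatten

variable {b : SchwartzMap E4 ℝ} {N K : ℕ} {θ C R : ℝ} {c : E4}
variable (h : OneStepW b N K θ C R) (hθ : 0 < θ) (hθ1 : θ < 1) (hR : 0 ≤ R) (S₀ : Stage N c)

/-- The scale of the atom with flattened index `⟨r, j⟩` is `θ^{r+1} σ₀`. -/
theorem scaleTW_eq (i : IdxW h hθ hθ1 hR S₀) : scaleTW h hθ hθ1 hR S₀ i = θ ^ (i.1 + 1) * S₀.σ := by
  rw [scaleTW, stageW_σ]; ring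

/-- The WEIGHTED coefficients `|a_i| (σ₀/σ_i)^K` are absolutely summable, with the geometric total bound. -/
theorem summable_wabs_coefTW (hC : 0 ≤ C) :
    Summable (fun i : IdxW h hθ hθ1 hR S₀ => |coefTW h hθ hθ1 hR S₀ i| * ((scaleTW h hθ hθ1 hR S₀ i) ^ K)⁻¹) ∧
      ∑' i : IdxW h hθ hθ1 hR S₀, |coefTW h hθ hθ1 hR S₀ i| * ((scaleTW h hθ hθ1 hR S₀ i) ^ K)⁻¹ ≤
        (C * ((S₀.ϱ + R * θ * S₀.σ / (1 - θ)) / (θ * S₀.σ)) ^ 4 * S₀.A * ((θ * S₀.σ) ^ K)⁻¹) / (1 - θ) := by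
  set Kc := C * ((S₀.ϱ + R * θ * S₀.σ / (1 - θ)) / (θ * S₀.σ)) ^ 4 * S₀.A * ((θ * S₀.σ) ^ K)⁻¹ with hKc
  set g : IdxW h hθ hθ1 hR S₀ → ℝ := fun i => |coefTW h hθ hθ1 hR S₀ i| * ((scaleTW h hθ hθ1 hR S₀ i) ^ K)⁻¹
    with hg
  have hg0 : ∀ i, 0 ≤ g i := fun i => by
    rw [hg]
    exact mul_nonneg (abs_nonneg _)
      (inv_nonneg.2 (pow_nonneg (mul_pos hθ (stageW h hθ hθ1.le hR S₀ i.1).hσ).le K))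
  have hgeom : Summable fun r : ℕ => Kc * θ ^ r := (summable_geometric_of_lt_one hθ.le hθ1).mul_left Kc
  have hinner : ∀ r, Summable fun j : Fin (roundW h (stageW h hθ hθ1.le hR S₀ r)).J => g ⟨r, j⟩ :=
    fun r => (hasSum_fintype _).summable
  have houter_le : ∀ r, ∑' j : Fin (roundW h (stageW h hθ hθ1.le hR S₀ r)).J, g ⟨r, j⟩ ≤ Kc * θ ^ r := by
    intro r
    rw [tsum_fintype]
    have hrw : ∀ j : Fin (roundW h (stageW h hθ hθ1.le hR S₀ r)).J,
        g ⟨r, j⟩ = |(roundW h (stageW h hθ hθ1.le hR S₀ r)).a j| * ((θ ^ (r + 1) * S₀.σ) ^ K)⁻¹ := by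
      intro j
      show |coefTW h hθ hθ1 hR S₀ ⟨r, j⟩| * ((scaleTW h hθ hθ1 hR S₀ ⟨r, j⟩) ^ K)⁻¹ = _
      rw [scaleTW_eq]; rfl
    simp_rw [hrw, ← Finset.sum_mul]
    exact wmassW_le_geom h hθ hθ1 hR S₀ r hC
  have houter : Summable fun r => ∑' j : Fin (roundW h (stageW h hθ hθ1.le hR S₀ r)).J, g ⟨r, j⟩ :=
    Summable.of_nonneg_of_le (fun r => tsum_nonneg fun j => hg0 _) houter_le hgeom
  have hS : Summable g := (summable_sigma_of_nonneg hg0).2 ⟨hinner, houter⟩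
  refine ⟨hS, ?_⟩
  show ∑' i, g i ≤ Kc / (1 - θ)
  rw [hS.tsum_sigma' hinner]
  calc ∑' r, ∑' j : Fin (roundW h (stageW h hθ hθ1.le hR S₀ r)).J, g ⟨r, j⟩
      ≤ ∑' r : ℕ, Kc * θ ^ r := Summable.tsum_le_tsum houter_le houter hgeom
    _ = Kc / (1 - θ) := by
        rw [tsum_mul_left, tsum_geometric_of_lt_one hθ.le hθ1]; ring

/-- The (unweighted) coefficients are absolutely summable (the weights are `≥ 1` once `θσ₀ ≤ 1`; here directly from the
unweighted geometric bound). -/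
theorem summable_abs_coefTW (hC : 0 ≤ C) :
    Summable (fun i : IdxW h hθ hθ1 hR S₀ => |coefTW h hθ hθ1 hR S₀ i|) := by
  set Kc := C * ((S₀.ϱ + R * θ * S₀.σ / (1 - θ)) / (θ * S₀.σ)) ^ 4 * S₀.A * ((θ * S₀.σ) ^ K)⁻¹ with hKc
  set W : ℝ := max 1 (S₀.σ ^ K) with hW
  have hgeom : Summable fun r : ℕ => Kc * W * θ ^ r := (summable_geometric_of_lt_one hθ.le hθ1).mul_left _
  have hinner : ∀ r, Summable fun j : Fin (roundW h (stageW h hθ hθ1.le hR S₀ r)).J =>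
      |coefTW h hθ hθ1 hR S₀ ⟨r, j⟩| := fun r => (hasSum_fintype _).summable
  have houter_le : ∀ r, ∑' j : Fin (roundW h (stageW h hθ hθ1.le hR S₀ r)).J, |coefTW h hθ hθ1 hR S₀ ⟨r, j⟩| ≤
      Kc * W * θ ^ r := by
    intro r
    rw [tsum_fintype]
    have hwpos : 0 < (θ ^ (r + 1) * S₀.σ) ^ K := pow_pos (mul_pos (pow_pos hθ _) S₀.hσ) K
    have h2 := wmassW_le_geom h hθ hθ1 hR S₀ r hC
    have h3 : ∑ j, |(roundW h (stageW h hθ hθ1.le hR S₀ r)).a j| ≤ Kc * θ ^ r * (θ ^ (r + 1) * S₀.σ) ^ K := by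
      have := mul_le_mul_of_nonneg_right h2 hwpos.le
      rwa [mul_assoc (∑ j, _), inv_mul_cancel₀ hwpos.ne', mul_one] at this
    have hw : (θ ^ (r + 1) * S₀.σ) ^ K ≤ W := by
      rw [mul_pow]
      have h1 : (θ ^ (r + 1)) ^ K ≤ 1 := pow_le_one₀ (pow_nonneg hθ.le _) (pow_le_one₀ hθ.le hθ1.le)
      calc (θ ^ (r + 1)) ^ K * S₀.σ ^ K ≤ 1 * S₀.σ ^ K :=
            mul_le_mul_of_nonneg_right h1 (pow_nonneg S₀.hσ.le K)
        _ ≤ W := by rw [one_mul]; exact le_max_right _ _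
    have hKc0 : 0 ≤ Kc * θ ^ r := by
      have := (Finset.sum_nonneg fun j _ => abs_nonneg ((roundW h (stageW h hθ hθ1.le hR S₀ r)).a j)).trans h3
      rcases (mul_nonneg_iff_of_pos_right hwpos).1 this with h0
      exact h0
    calc ∑ j, |coefTW h hθ hθ1 hR S₀ ⟨r, j⟩| = ∑ j, |(roundW h (stageW h hθ hθ1.le hR S₀ r)).a j| := rfl
      _ ≤ Kc * θ ^ r * (θ ^ (r + 1) * S₀.σ) ^ K := h3
      _ ≤ Kc * θ ^ r * W := mul_le_mul_of_nonneg_left hw hKc0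
      _ = Kc * W * θ ^ r := by ring
  have houter : Summable fun r => ∑' j : Fin (roundW h (stageW h hθ hθ1.le hR S₀ r)).J,
      |coefTW h hθ hθ1 hR S₀ ⟨r, j⟩| :=
    Summable.of_nonneg_of_le (fun r => tsum_nonneg fun j => abs_nonneg _) houter_le hgeom
  exact (summable_sigma_of_nonneg (fun i => abs_nonneg _)).2 ⟨hinner, houter⟩

/-- Pointwise synthesis over the sigma index (weighted iteration). -/
theorem hasSum_sigmaW (hC : 0 ≤ C) (z : E4) :
    Summable (fun i : IdxW h hθ hθ1 hR S₀ => atomW h hθ hθ1 hR S₀ i.1 i.2 z) ∧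
      ∑' i : IdxW h hθ hθ1 hR S₀, atomW h hθ hθ1 hR S₀ i.1 i.2 z = S₀.f z := by
  obtain ⟨B, hBpos, hB⟩ := b.decay 0 0
  have hB' : ∀ x, |b x| ≤ B := fun x => by simpa [norm_iteratedFDeriv_zero, Real.norm_eq_abs] using hB x
  have hS := summable_abs_coefTW h hθ hθ1 hR S₀ hC
  have hG : Summable (fun i : IdxW h hθ hθ1 hR S₀ => atomW h hθ hθ1 hR S₀ i.1 i.2 z) := by
    refine Summable.of_norm_bounded (g := fun i => |coefTW h hθ hθ1 hR S₀ i| * B) (hS.mul_right B) fun i => ?_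
    rw [Real.norm_eq_abs, ← atomW_eq, abs_mul]
    exact mul_le_mul_of_nonneg_left (hB' _) (abs_nonneg _)
  refine ⟨hG, ?_⟩
  rw [hG.tsum_sigma' (fun r => (hasSum_fintype _).summable)]
  simp_rw [tsum_fintype]
  exact (hasSum_roundsW h hθ hθ1 hR S₀ hC z).tsum_eq

/-- The `ℕ`-extension `extW` agrees with `g` at encoded indices. -/
theorem extW_encode {X : Type} (g : IdxW h hθ hθ1 hR S₀ → X) (d : X) (i : IdxW h hθ hθ1 hR S₀) :
    extW h hθ hθ1 hR S₀ g d (Encodable.encode i) = g i := by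
  simp [extW]

/-- Every value of the `ℕ`-extension `extW` is a value of `g` or the default. -/
theorem extW_cases {X : Type} (g : IdxW h hθ hθ1 hR S₀ → X) (d : X) (n : ℕ) :
    extW h hθ hθ1 hR S₀ g d n = d ∨ ∃ i, Encodable.encode i = n ∧ extW h hθ hθ1 hR S₀ g d n = g i := by
  unfold extW
  cases hn : Encodable.decode₂ (IdxW h hθ hθ1 hR S₀) n with
  | none => left; simp
  | some i => right; exact ⟨i, Encodable.decode₂_eq_some.1 hn, by simp⟩

/-- The support of the `ℕ`-extension `extW g 0` lies in the range of the encoding. -/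
theorem support_extW_subset (g : IdxW h hθ hθ1 hR S₀ → ℝ) :
    Function.support (extW h hθ hθ1 hR S₀ g 0) ⊆ Set.range (Encodable.encode : IdxW h hθ hθ1 hR S₀ → ℕ) := by
  intro n hn
  rcases extW_cases h hθ hθ1 hR S₀ g 0 n with h0 | ⟨i, hi, -⟩
  · exact absurd h0 hn
  · exact ⟨i, hi⟩

/-- The sum of the `ℕ`-extension `extW g 0` equals the sum of `g`. -/
theorem tsum_extW (g : IdxW h hθ hθ1 hR S₀ → ℝ) :
    ∑' n, extW h hθ hθ1 hR S₀ g 0 n = ∑' i, g i := by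
  rw [← (Encodable.encode_injective).tsum_eq (support_extW_subset h hθ hθ1 hR S₀ g)]
  simp_rw [extW_encode]

/-- The `ℕ`-extension `extW g 0` of a summable family is summable. -/
theorem summable_extW {g : IdxW h hθ hθ1 hR S₀ → ℝ} (hg : Summable g) :
    Summable (extW h hθ hθ1 hR S₀ g 0) := by
  rw [← (Encodable.encode_injective).summable_iff (fun n hn => by
    by_contra hne
    exact hn (support_extW_subset h hθ hθ1 hR S₀ g (Function.mem_support.2 hne)))]
  have : (extW h hθ hθ1 hR S₀ g 0) ∘ Encodable.encode = g := funext fun i => extW_encode h hθ hθ1 hR S₀ g 0 i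
  rw [this]; exact hg

end Flatten

/-! ## `OneStepW ⇒ SlotSynthW` -/

/-- **Weighted H5.** Iterating one weighted round gives weighted single-slot synthesis with
`C₁ = C q⁴ (θs)^{-K}/(1−θ)`, `q = (3/2 + Rθs/(1−θ))/(θs)`, `s = (1−θ)/(2(R+1))` (the atom of round `r` has scale
`θ^{r+1} s ρ`, so its weight `(ρ/σ)^K = (θ^{r+1}s)^{-K}` is `ρ`-free). [folklore] -/
theorem slotSynthW_of_oneStepW (b : SchwartzMap E4 ℝ) (N K : ℕ) (θ C R : ℝ) (hθ : 0 < θ) (hθ1 : θ < 1)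
    (hC : 0 ≤ C) (hR : 0 ≤ R) (h : OneStepW b N K θ C R) :
    ∃ C₁ : ℝ, 0 ≤ C₁ ∧ SlotSynthW b C₁ N K := by
  -- the initial relative scale
  set s : ℝ := (1 - θ) / (2 * (R + 1)) with hs
  have h1θ : 0 < 1 - θ := by linarith
  have hs0 : 0 < s := div_pos h1θ (by positivity)
  have hs1 : s ≤ 1 := by
    rw [hs, div_le_one (by positivity)]; nlinarith
  set q : ℝ := (3 / 2 + R * θ * s / (1 - θ)) / (θ * s) with hq
  have hq0 : 0 ≤ q := by rw [hq]; positivity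
  refine ⟨C * q ^ 4 * ((θ * s) ^ K)⁻¹ / (1 - θ), by positivity, ?_⟩
  intro ψ c ρ M' hρ hsupp hbd
  set S₀ : Stage N c := stage₀ ψ c ρ M' s hρ hs0 hs1 hsupp hbd with hS₀def
  have hS₀f : S₀.f = ψ := rfl
  have hS₀ϱ : S₀.ϱ = 3 / 2 * ρ := rfl
  have hS₀σ : S₀.σ = s * ρ := rfl
  have hS₀A : S₀.A = M' := rfl
  -- the key constant identity: `(P/(θσ₀)) = q` (ρ cancels)
  have hPq : (S₀.ϱ + R * θ * S₀.σ / (1 - θ)) / (θ * S₀.σ) = q := by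
    rw [hS₀ϱ, hS₀σ, hq]
    have hρ0 : ρ ≠ 0 := hρ.ne'
    have hθ0 : θ ≠ 0 := hθ.ne'
    have hs0' : s ≠ 0 := hs0.ne'
    have h1 : (1 - θ) ≠ 0 := h1θ.ne'
    field_simp
  -- `P ≤ 2ρ`
  have hP2 : S₀.ϱ + R * θ * S₀.σ / (1 - θ) ≤ 2 * ρ := by
    rw [hS₀ϱ, hS₀σ]
    have : R * θ * (s * ρ) / (1 - θ) ≤ ρ / 2 := by
      rw [div_le_iff₀ h1θ, hs]
      have hRθ : R * θ ≤ R + 1 := by nlinarith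
      have : R * θ * ((1 - θ) / (2 * (R + 1)) * ρ) = (R * θ / (R + 1)) * ((1 - θ) * ρ) / 2 := by
        field_simp
      rw [this]
      have h3 : R * θ / (R + 1) ≤ 1 := by rw [div_le_one (by positivity)]; exact hRθ
      nlinarith [mul_nonneg h1θ.le hρ.le]
    linarith
  -- the weight of atom `i` in terms of `ρ`: `(ρ/σ_i)^K = ((θ^{r+1} s ρ)^K)⁻¹ ρ^K`
  have hwt : ∀ i : IdxW h hθ hθ1 hR S₀, (ρ / scaleTW h hθ hθ1 hR S₀ i) ^ K =
      ρ ^ K * ((scaleTW h hθ hθ1 hR S₀ i) ^ K)⁻¹ := fun i => by rw [div_pow, div_eq_mul_inv]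
  -- witnesses
  refine ⟨extW h hθ hθ1 hR S₀ (coefTW h hθ hθ1 hR S₀) 0, extW h hθ hθ1 hR S₀ (scaleTW h hθ hθ1 hR S₀) ρ,
    extW h hθ hθ1 hR S₀ (centreTW h hθ hθ1 hR S₀) c, ?_, ?_, ?_, ?_⟩
  -- (1) weighted absolute summability of the coefficients
  · have habs : (fun n => |extW h hθ hθ1 hR S₀ (coefTW h hθ hθ1 hR S₀) 0 n| *
        (ρ / extW h hθ hθ1 hR S₀ (scaleTW h hθ hθ1 hR S₀) ρ n) ^ K) =
        extW h hθ hθ1 hR S₀ (fun i => ρ ^ K * (|coefTW h hθ hθ1 hR S₀ i| * ((scaleTW h hθ hθ1 hR S₀ i) ^ K)⁻¹))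
          0 := by
      funext n
      unfold extW
      cases Encodable.decode₂ (IdxW h hθ hθ1 hR S₀) n with
      | none => simp
      | some i => simp only [Option.elim_some]; rw [hwt]; ring
    rw [habs]
    exact summable_extW h hθ hθ1 hR S₀ ((summable_wabs_coefTW h hθ hθ1 hR S₀ hC).1.mul_left _)
  -- (2) the weighted mass bound
  · have habs : ∀ n, |extW h hθ hθ1 hR S₀ (coefTW h hθ hθ1 hR S₀) 0 n| *
        (ρ / extW h hθ hθ1 hR S₀ (scaleTW h hθ hθ1 hR S₀) ρ n) ^ K =
        extW h hθ hθ1 hR S₀ (fun i => ρ ^ K * (|coefTW h hθ hθ1 hR S₀ i| * ((scaleTW h hθ hθ1 hR S₀ i) ^ K)⁻¹))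
          0 n := by
      intro n
      unfold extW
      cases Encodable.decode₂ (IdxW h hθ hθ1 hR S₀) n with
      | none => simp
      | some i => simp only [Option.elim_some]; rw [hwt]; ring
    rw [tsum_congr habs, tsum_extW, tsum_mul_left]
    have hb := (summable_wabs_coefTW h hθ hθ1 hR S₀ hC).2
    rw [hPq, hS₀A, hS₀σ] at hb
    refine (mul_le_mul_of_nonneg_left hb (pow_nonneg hρ.le K)).trans (le_of_eq ?_)
    have hρ0 : ρ ≠ 0 := hρ.ne'
    have hθ0 : θ ≠ 0 := hθ.ne'
    have hs0' : s ≠ 0 := hs0.ne'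
    have h1 : (1 - θ) ≠ 0 := h1θ.ne'
    rw [show θ * (s * ρ) = (θ * s) * ρ by ring, mul_pow]
    field_simp
  -- (3) scales and centres
  · intro n
    unfold extW
    cases Encodable.decode₂ (IdxW h hθ hθ1 hR S₀) n with
    | none => simp [hρ, hρ.le]
    | some i =>
      obtain ⟨r, j⟩ := i
      simp only [Option.elim_some, scaleTW, centreTW]
      have hσr : (stageW h hθ hθ1.le hR S₀ r).σ = θ ^ r * (s * ρ) := by rw [stageW_σ, hS₀σ]
      refine ⟨mul_pos hθ (stageW h hθ hθ1.le hR S₀ r).hσ, ?_, ?_⟩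
      · rw [hσr]
        have h1 : θ * θ ^ r ≤ 1 := by
          rw [← pow_succ']; exact pow_le_one₀ hθ.le hθ1.le
        have h2 : θ * (θ ^ r * (s * ρ)) = (θ * θ ^ r) * s * ρ := by ring
        rw [h2]
        have h3 : (θ * θ ^ r) * s ≤ 1 := by
          calc (θ * θ ^ r) * s ≤ 1 * 1 := mul_le_mul h1 hs1 hs0.le zero_le_one
            _ = 1 := one_mul 1
        nlinarith
      · have hη := (roundW h (stageW h hθ hθ1.le hR S₀ r)).hη j
        have hϱ := stageW_ϱ_le h hθ hθ1 hR S₀ r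
        linarith
  -- (4) pointwise synthesis
  · intro z
    have hfun : ∀ n, extW h hθ hθ1 hR S₀ (coefTW h hθ hθ1 hR S₀) 0 n *
        b ((extW h hθ hθ1 hR S₀ (scaleTW h hθ hθ1 hR S₀) ρ n)⁻¹ •
          (z - extW h hθ hθ1 hR S₀ (centreTW h hθ hθ1 hR S₀) c n)) =
        extW h hθ hθ1 hR S₀ (fun i => atomW h hθ hθ1 hR S₀ i.1 i.2 z) 0 n := by
      intro n
      unfold extW
      cases Encodable.decode₂ (IdxW h hθ hθ1 hR S₀) n with
      | none => simp
      | some i => simp only [Option.elim_some]; exact atomW_eq h hθ hθ1 hR S₀ i z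
    rw [tsum_congr hfun, tsum_extW, (hasSum_sigmaW h hθ hθ1 hR S₀ hC z).2, hS₀f]

end Summit.QuantumFields.YangMills.Theorems.AtomicSynthesisWeighted

end
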